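import Literature.MathematicalPhysics.QuantumFieldTheory.Balaban1983to89.Beta.WindowLog

/-!
# `Balaban1983to89.Beta.DyadicShell` — β sub-cell LEAD kernel (strat-b12 gen 4): the DYADIC SHELL RATE —
`DyadicData ⇒ DyadicRate`, i.e. the hypothesis shape of `Beta.WindowLog` DISCHARGED for dyadically homogeneous lattice
kernels on `ℤ⁴`, with the continuum-homogeneous class (`HomogKernel`: degree `−4`, bounded on the unit sup-sphere, Lipschitz
on a shell) restricted to `ℤ⁴` as the instance the window estimate (L4) produces

HONEST FRAMING (cell rule, verbatim): discharging `BetaPertH` makes Bałaban's UV stability UNCONDITIONAL — a real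
constructive-QFT result; it is NOT the continuum limit and NOT the Clay problem.  THIS MODULE DISCHARGES NOTHING of the series
and asserts NOTHING of Bałaban's papers: it is elementary real analysis on `ℤ⁴` (finite sums over the tree's
`LatticeModels.box` / `annulus`, one Cauchy-sequence argument).  Value = kernel bookkeeping for item (L4) (window power
counting) of the ONE open statement (M2⁺) in its one-step / large-`L` form (AF-0-L) (BETA-SPEC v1.8 §8.6; tree
`Beta.LargeL.LogGrowthLower`: `β⁰_{k+1}(L) ≥ b·log L − A`), NOT summit progress (audit cell `pub-balaban`, unit
`b2b-balaban-strat-b12` gen 4; prose `run/shared/lean/pub/pub-balaban/BETA-SPEC.md` §8.6 (L4), `BETA/AN5.md` §4).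

THE POINT.  `Beta.WindowLog.windowLog_sharp` (row an5) turns a GEOMETRIC RATE for the dyadic shell sums of a marginal
lattice kernel `f : ℤ⁴ → ℝ` — its hypothesis shape `DyadicRate (shellSum f) I C`: `|Σ_{2^j<‖w‖_∞≤2^{j+1}} f − I| ≤ C·2^{−j}`
— into `Σ_{0<‖w‖_∞≤M} f = (I/log 2)·log M + O(1)` with an explicit `O(1)`; there the rate is ASSUMED.  Here it is PROVED, from
three properties of the kernel `h` on `ℤ⁴ ∖ 0` (structure `DyadicData h C`, §2):
  (homog) `h(2w) = h(w)/16`;  (reg) `|h(w+ε) − h(w)| ≤ C‖w‖_∞⁻⁵` for parity corners `ε ∈ {0,1}⁴`, `‖w‖_∞ ≥ 2`;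
  (size) `|h(w)| ≤ C‖w‖_∞⁻⁴`.
Mechanism (§3, the discrete parent map): every `w ∈ ℤ⁴` is uniquely `2v + ε` with `ε ∈ {0,1}⁴` (`v = ⌊w/2⌋` coordinatewise);
the image of `{R < ‖v‖_∞ ≤ 2R} × {0,1}⁴` differs from the annulus `{2R < ‖w‖_∞ ≤ 4R}` only on the two spheres `‖w‖_∞ = 2R+1`,
`4R+1` (sphere sums `≤ 80C/(r+1)` by (size) and `TransferUV.card_annulus_succ_four_le`); on the image, (reg) replaces `h(2v+ε)` by
`h(2v)` at total cost `≤ 16(4R+1)⁴·C/(2(R+1))⁵ ≤ 128C/(R+1)`, and (homog) gives `Σ_{v,ε} h(2v) = 16·Σ_v h(v)/16 = D(R)`.  Hence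
  `|D(2R) − D(R)| ≤ 288·C/(R+1)`,   `D(R) := Σ_{R<‖w‖_∞≤2R} h(w)`            (`abs_dyadicSum_two_mul_sub_le`),
so `D(2^j)` is Cauchy at the geometric rate and (§4, Mathlib `cauchySeq_of_le_geometric_two`)
  `∃ I, ∀ j, |D(2^j) − I| ≤ 576·C·2^{−j}`                                         (`exists_rate`),
i.e. (§5) `∃ I, DyadicRate (shellSum h) I (576·C)` (`dyadicRate`) and, through `windowLog_sharp` with `A = C`,
  `|Σ_{0<‖w‖_∞≤M} h(w) − (I/log 2)·log M| ≤ 1312·C + |I|`  for all `M ≥ 1`               (`windowLog`).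
§6: a continuum kernel `F : ℝ⁴ → ℝ`, positively homogeneous of degree `−4` (`F(tx) = F(x)/t⁴`, `t > 0`, `x ≠ 0`), `|F| ≤ A`
on the unit sup-sphere and `Λ`-Lipschitz (sup-norm) on the shell `1/2 ≤ ‖x‖_∞ ≤ 2` (structure `HomogKernel F A Λ`; e.g.
`F(x) = K(x/|x|)|x|⁻⁴`, `K` Lipschitz on `S³`) restricts to `DyadicData (F ∘ toReal) (A + Λ)` (`dyadicData_of_homogKernel`), so
the (L4) ⇒ (L5) interface `windowLog_of_homogKernel` is hypothesis-free for that class.  §7: the canonical marginal kernel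
`‖w‖_∞⁻⁴` satisfies `DyadicData _ 30` (`Witness.dyadicData_quartic`; the constant is forced positive by (reg)/(size)).

WHAT THIS DOES NOT DO.  (i) The VALUE of the limit (`I = ∫_{1<‖x‖_∞≤2} F dx = log 2·∫_{S³} K dσ` for `F = K(x/|x|)|x|⁻⁴`) is
not derived: `I` is the limit of the FINITE lattice sums `D(2^j)` with the proved tail `576·C·2^{−j}` — the object certified
arithmetic can bracket (BETA-SPEC §8.6 (L5)).  (ii) That Bałaban's Ward-reorganised one-loop integrand on the fluctuation lattice
has its leading part in the class `HomogKernel` — items (L1) low-momentum parametrix at `U = 1`, (L2) vertices, (L3) exact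
per-piece Ward — is the analytic content of (M2⁺) and is NOT touched here.  (iii) Constants (`288`, `576`, `1312`, `30`) are
crude by design.

CITATION HEADER (lean-in-tree rule): no statement of the papers under audit is used or quoted in any declaration.  Context
pointers only: T. Bałaban, Commun. Math. Phys. **109** (1987) 249–301 [Balaban1987RG1] — the object `β_{k+1}` of (1.22) p.264,
and the lattice convention p.251 l.23 «where L is an odd, positive integer > 11, and m is a positive integer» (held text
`paper-balaban1987-cmp109-rg-i-small-field` p0003 l.23).  Every declaration below is [folklore] (dyadic decomposition of
lattice sums of homogeneous kernels).

CONTENTS (0 sorry): §1 the integer sup-norm `supNorm` on `ℤ⁴` vs the tree's `box`/`annulus` (`mem_box_iff`, `mem_annulus_iff`),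
doubling and the parity decomposition `w = 2·half w + parity w` (`corners`, `decomp_injective`); §2 `DyadicData`, `dyadicSum`,
sphere sums (`sum_sphere_abs_le`); §3 the shell comparison (`pairs`, `dbl`, `dblImage`, `sum_dblImage`,
`mem_sphere_of_mem_sdiff`/`'`, `sum_pairs_reg_le`, `sum_pairs_homog`, `abs_dyadicSum_two_mul_sub_le`); §4 the rate
(`exists_rate`) and the dyadic cut-off statement (`sum_annulus_zero_two_pow`, `abs_sum_annulus_zero_two_pow_sub_le`); §5 the
bridge to `Beta.WindowLog` (`sum_Ico_shellSum`, `dyadicBlock_shellSum_eq`, `dyadicRate`, `windowLog`); §6 `toReal`,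
`norm_toReal`, `HomogKernel`, `dyadicData_of_homogKernel`, `windowLog_of_homogKernel`; §7 `Witness.quartic`.

v1.1 ADDENDUM (append-only §8, same seat): the PERTURBED form the shape items (L1)–(L3) actually deliver — `f = h + g`, `h` with
`DyadicData h C`, `|g| ≤ C″‖w‖_∞⁻⁵` shellwise ⇒ same coefficient `I/log 2`, `O(1)` enlarged by `160·C″`
(`TransferUV.abs_sum_le_of_quintic`): `windowLog_of_perturbed`, `windowLog_of_homogKernel_perturbed`, and the two-sided form
`logGrowth_two_sided` (`b·log M − A₀ ≤ Σ_{0<‖w‖_∞≤M} f ≤ b·log M + A₀`, the inequality shape of `Beta.LargeL.LogGrowthLower`).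
v1.2 ADDENDUM (append-only §9, same seat): the continuum class is inhabited non-trivially — `Witness.homogKernel_quarticR :
HomogKernel ‖·‖_∞⁻⁴ 1 128` (Lipschitz bound `|a⁻⁴ − b⁻⁴| ≤ 128|a − b|` on `a, b ≥ 1/2`), `Witness.dyadicData_quarticR`.
v1.3 ADDENDUM (append-only §10, same seat): THE SIGN FROM POINTWISE FACTS — `le_of_dyadicRate` (eventual lower bounds of the
block sums pass to the limit), `dyadicSum_ge_of_cube` (F homogeneous, `≥ 0` on the shell, `≥ c` on a cube `x₀ + [0,δ]⁴` inside
the shell ⇒ `D(R) ≥ c(δ/2)⁴` once `Rδ ≥ 2`), `coeff_pos_of_cube` (`⇒ I ≥ c(δ/2)⁴ > 0`): the kernel form of (L5) when the leading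
kernel is (positive scalar) × (nonnegative homogeneous structure), e.g. the transverse `x₁²x₂²/|x|⁸`.
v1.4 ADDENDUM (append-only §11, same seat): both hypothesis classes are CONES — `DyadicData.add/smul`, `HomogKernel.add/smul`,
`dyadicSum_add/smul`, `dyadicRate_add/smul` (coefficients add and scale) — so a leading kernel delivered piecewise (the
(S′-exact) four pieces) is assembled with its coefficient `I = Σ I_piece`.
-/

namespace Literature.MathematicalPhysics.QuantumFieldTheory.Balaban1983to89.Beta.DyadicShell

open Finset
open Literature.Probability.LatticeModels (box mem_box card_box box_mono zero_mem_box annulus mem_annulus)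
open Literature.MathematicalPhysics.QuantumFieldTheory.Balaban1983to89.Beta.TransferUV (card_annulus_succ_four_le
  sum_annulus_zero_eq_sum_shells)
open Literature.MathematicalPhysics.QuantumFieldTheory.Balaban1983to89.Beta.WindowLog (dyadicBlock DyadicRate shellSum
  windowLog_sharp)

noncomputable section

/-- Points of `ℤ⁴`. [folklore] -/
abbrev Pt : Type := Fin 4 → ℤ

/-! ## 1. The sup-norm on `ℤ⁴` and the tree's boxes / annuli -/

/-- The sup-norm `‖w‖_∞ = max_i |w_i|` as a natural number. [folklore] -/
def supNorm (w : Pt) : ℕ := Finset.univ.sup fun i => (w i).natAbs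

/-- Each coordinate is bounded by the sup-norm. [folklore] -/
theorem natAbs_le_supNorm (w : Pt) (i : Fin 4) : (w i).natAbs ≤ supNorm w :=
  Finset.le_sup (f := fun i => (w i).natAbs) (Finset.mem_univ i)

/-- `‖w‖_∞ ≤ n` iff every coordinate has `|w_i| ≤ n`. [folklore] -/
theorem supNorm_le_iff {w : Pt} {n : ℕ} : supNorm w ≤ n ↔ ∀ i, (w i).natAbs ≤ n := by
  unfold supNorm
  rw [Finset.sup_le_iff]
  simp

/-- The sup-norm is attained at some coordinate. [folklore] -/
theorem exists_eq_supNorm (w : Pt) : ∃ i, (w i).natAbs = supNorm w := by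
  obtain ⟨i, -, hi⟩ := Finset.exists_mem_eq_sup (Finset.univ : Finset (Fin 4)) Finset.univ_nonempty
    (fun i => (w i).natAbs)
  exact ⟨i, hi.symm⟩

/-- `natAbs z ≤ L ↔ -L ≤ z ≤ L`. [folklore] -/
theorem natAbs_le_iff_mem {z : ℤ} {L : ℕ} : z.natAbs ≤ L ↔ -(L : ℤ) ≤ z ∧ z ≤ L := by
  rw [← Int.ofNat_le, Int.natCast_natAbs, abs_le]

/-- Membership in the tree's box `box 4 L` (all `|w_i| ≤ L`) is `‖w‖_∞ ≤ L`. [folklore] -/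
theorem mem_box_iff {L : ℕ} {w : Pt} : w ∈ box 4 L ↔ supNorm w ≤ L := by
  rw [mem_box, supNorm_le_iff]
  exact forall_congr' fun i => natAbs_le_iff_mem.symm

/-- Non-membership in `box 4 L` is `L < ‖w‖_∞`. [folklore] -/
theorem not_mem_box_iff {L : ℕ} {w : Pt} : w ∉ box 4 L ↔ L < supNorm w := by
  rw [mem_box_iff, not_le]

/-- Membership in the tree's annulus `annulus 4 r R = box R \ box r` is `r < ‖w‖_∞ ≤ R`. [folklore] -/
theorem mem_annulus_iff {r R : ℕ} {w : Pt} : w ∈ annulus 4 r R ↔ r < supNorm w ∧ supNorm w ≤ R := by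
  rw [mem_annulus, mem_box_iff, not_mem_box_iff]
  exact and_comm

/-- `‖w‖_∞ = 0 ↔ w = 0`. [folklore] -/
theorem supNorm_eq_zero_iff {w : Pt} : supNorm w = 0 ↔ w = 0 := by
  constructor
  · intro h
    funext i
    have hi := natAbs_le_supNorm w i
    rw [h, Nat.le_zero, Int.natAbs_eq_zero] at hi
    exact hi
  · rintro rfl
    apply Nat.le_zero.mp
    exact supNorm_le_iff.mpr fun i => by simp

/-- A nonzero point has positive sup-norm. [folklore] -/
theorem supNorm_pos {w : Pt} (hw : w ≠ 0) : 0 < supNorm w :=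
  Nat.pos_of_ne_zero fun h => hw (supNorm_eq_zero_iff.mp h)

/-- Coordinates of `2 • v`. [folklore] -/
theorem two_smul_apply (v : Pt) (i : Fin 4) : (2 • v) i = 2 * v i := by
  simp only [Pi.smul_apply, nsmul_eq_mul, Nat.cast_ofNat]

/-- `|(2•v)_i| = 2|v_i|`. [folklore] -/
theorem natAbs_two_smul_apply (v : Pt) (i : Fin 4) : ((2 • v) i).natAbs = 2 * (v i).natAbs := by
  rw [two_smul_apply, Int.natAbs_mul]
  rfl

/-- The sup-norm of `2 • v` is `2‖v‖_∞`. [folklore] -/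
theorem supNorm_two_smul (v : Pt) : supNorm (2 • v) = 2 * supNorm v := by
  apply le_antisymm
  · refine supNorm_le_iff.mpr fun i => ?_
    rw [natAbs_two_smul_apply]
    exact Nat.mul_le_mul_left _ (natAbs_le_supNorm v i)
  · obtain ⟨i, hi⟩ := exists_eq_supNorm v
    have h := natAbs_le_supNorm (2 • v) i
    rw [natAbs_two_smul_apply, hi] at h
    exact h

/-! ### The sixteen parity corners `ε ∈ {0,1}⁴` -/

/-- The corner set `{0,1}⁴ ⊂ ℤ⁴`. [folklore] -/
def corners : Finset Pt := Fintype.piFinset fun _ => ({0, 1} : Finset ℤ)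

/-- Membership in `corners`. [folklore] -/
theorem mem_corners {ε : Pt} : ε ∈ corners ↔ ∀ i, ε i = 0 ∨ ε i = 1 := by
  simp [corners, Fintype.mem_piFinset]

/-- `#corners = 16`. [folklore] -/
theorem card_corners : corners.card = 16 := by
  rw [corners, Fintype.card_piFinset_const]
  simp

/-- A corner coordinate has `natAbs ≤ 1`. [folklore] -/
theorem natAbs_le_one_of_mem_corners {ε : Pt} (hε : ε ∈ corners) (i : Fin 4) : (ε i).natAbs ≤ 1 := by
  rcases mem_corners.mp hε i with h | h <;> simp [h]

/-- Upper bound `‖2v + ε‖_∞ ≤ 2‖v‖_∞ + 1`. [folklore] -/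
theorem supNorm_two_smul_add_le (v : Pt) {ε : Pt} (hε : ε ∈ corners) :
    supNorm (2 • v + ε) ≤ 2 * supNorm v + 1 := by
  refine supNorm_le_iff.mpr fun i => ?_
  have h1 : ((2 • v + ε) i).natAbs ≤ ((2 • v) i).natAbs + (ε i).natAbs := Int.natAbs_add_le _ _
  have h2 : ((2 • v) i).natAbs = 2 * (v i).natAbs := natAbs_two_smul_apply v i
  have h3 := natAbs_le_one_of_mem_corners hε i
  have h4 := natAbs_le_supNorm v i
  simp only [Pi.add_apply] at h1 ⊢
  omega

/-- Lower bound `2‖v‖_∞ ≤ ‖2v + ε‖_∞ + 1`. [folklore] -/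
theorem two_mul_supNorm_le (v : Pt) {ε : Pt} (hε : ε ∈ corners) :
    2 * supNorm v ≤ supNorm (2 • v + ε) + 1 := by
  obtain ⟨i, hi⟩ := exists_eq_supNorm v
  have h1 : ((2 • v) i).natAbs ≤ ((2 • v + ε) i).natAbs + (-ε i).natAbs := by
    have := Int.natAbs_add_le ((2 • v + ε) i) (-ε i)
    simp only [Pi.add_apply, add_neg_cancel_right] at this
    simpa only [Pi.add_apply] using this
  have h2 : ((2 • v) i).natAbs = 2 * (v i).natAbs := natAbs_two_smul_apply v i
  have h3 : (-ε i).natAbs ≤ 1 := by rw [Int.natAbs_neg]; exact natAbs_le_one_of_mem_corners hε i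
  have h4 := natAbs_le_supNorm (2 • v + ε) i
  omega

/-- The parity decomposition `w = 2v + ε` with `v_i = w_i / 2`, `ε_i = w_i % 2`. [folklore] -/
def half (w : Pt) : Pt := fun i => w i / 2

/-- The parity corner of `w`. [folklore] -/
def parity (w : Pt) : Pt := fun i => w i % 2

/-- `parity w ∈ corners`. [folklore] -/
theorem parity_mem_corners (w : Pt) : parity w ∈ corners :=
  mem_corners.mpr fun i => Int.emod_two_eq_zero_or_one (w i)

/-- `w = 2 • half w + parity w`. [folklore] -/
theorem two_smul_half_add_parity (w : Pt) : 2 • half w + parity w = w := by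
  funext i
  rw [Pi.add_apply, two_smul_apply]
  simp only [half, parity]
  have := Int.mul_ediv_add_emod (w i) 2
  linarith

/-- Uniqueness of the parity decomposition: `(v, ε) ↦ 2v + ε` is injective on `ℤ⁴ × corners`. [folklore] -/
theorem decomp_injective {v v' ε ε' : Pt} (hε : ε ∈ corners) (hε' : ε' ∈ corners)
    (h : 2 • v + ε = 2 • v' + ε') : v = v' ∧ ε = ε' := by
  have hc : ∀ i, v i = v' i ∧ ε i = ε' i := by
    intro i
    have hi := congr_fun h i
    simp only [Pi.add_apply, two_smul_apply] at hi
    rcases mem_corners.mp hε i with h0 | h0 <;> rcases mem_corners.mp hε' i with h1 | h1 <;> omega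
  exact ⟨funext fun i => (hc i).1, funext fun i => (hc i).2⟩

/-- From the parity decomposition: `2‖half w‖_∞ ≤ ‖w‖_∞ + 1`. [folklore] -/
theorem two_mul_supNorm_half_le (w : Pt) : 2 * supNorm (half w) ≤ supNorm w + 1 := by
  have h := two_mul_supNorm_le (half w) (parity_mem_corners w)
  rwa [two_smul_half_add_parity] at h

/-- From the parity decomposition: `‖w‖_∞ ≤ 2‖half w‖_∞ + 1`. [folklore] -/
theorem supNorm_le_two_mul_supNorm_half (w : Pt) : supNorm w ≤ 2 * supNorm (half w) + 1 := by
  have h := supNorm_two_smul_add_le (half w) (parity_mem_corners w)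
  rwa [two_smul_half_add_parity] at h

/-! ## 2. The hypotheses (exact dyadic homogeneity, one-step regularity, size) and the dyadic sums -/

/-- **HYPOTHESIS SHAPE.**  `h : ℤ⁴ → ℝ` is DYADICALLY HOMOGENEOUS OF DEGREE −4 with one-step regularity and size
constant `C`: (homog) `h(2w) = h(w)/16` for `w ≠ 0`; (reg) `|h(w + ε) − h(w)| ≤ C‖w‖_∞⁻⁵` for every parity corner
`ε ∈ {0,1}⁴` and `‖w‖_∞ ≥ 2`; (size) `|h(w)| ≤ C‖w‖_∞⁻⁴` for `w ≠ 0`.  The restriction to `ℤ⁴` of a continuum kernel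
positively homogeneous of degree `−4` and Lipschitz on a shell satisfies it (`dyadicData_of_homogKernel`, §6), as does
`‖w‖_∞⁻⁴` with `C = 30` (§7).  Nothing is asserted: it is the INPUT of the rate theorem. [folklore] -/
structure DyadicData (h : Pt → ℝ) (C : ℝ) : Prop where
  nonneg : 0 ≤ C
  homog : ∀ w : Pt, w ≠ 0 → h (2 • w) = h w / 16
  reg : ∀ w ε : Pt, ε ∈ corners → 2 ≤ supNorm w → |h (w + ε) - h w| ≤ C / (supNorm w : ℝ) ^ 5
  size : ∀ w : Pt, w ≠ 0 → |h w| ≤ C / (supNorm w : ℝ) ^ 4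

/-- The DYADIC SUM `D(R) = Σ_{R < ‖w‖_∞ ≤ 2R} h(w)` over the tree's annulus `annulus 4 R (2R)`. [folklore] -/
def dyadicSum (h : Pt → ℝ) (R : ℕ) : ℝ := ∑ w ∈ annulus 4 R (2 * R), h w

/-! ### Sphere sums (the count `#annulus 4 r (r+1) ≤ 80(r+1)³` is `TransferUV.card_annulus_succ_four_le`) -/

/-- On the sphere of radius `r+1` the sup-norm equals `r+1`. [folklore] -/
theorem supNorm_eq_of_mem_sphere {r : ℕ} {w : Pt} (hw : w ∈ annulus 4 r (r + 1)) : supNorm w = r + 1 := by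
  have h := mem_annulus_iff.mp hw
  omega

/-- Points of an annulus `annulus 4 r R` are nonzero. [folklore] -/
theorem ne_zero_of_mem_annulus {r R : ℕ} {w : Pt} (hw : w ∈ annulus 4 r R) : w ≠ 0 := by
  intro h0
  have h := (mem_annulus_iff.mp hw).1
  rw [h0, supNorm_eq_zero_iff.mpr rfl] at h
  exact Nat.not_lt_zero _ h

/-- The sphere sum of `|h|` is at most `80C/(r+1)`. [folklore] -/
theorem sum_sphere_abs_le {h : Pt → ℝ} {C : ℝ} (hD : DyadicData h C) (r : ℕ) :
    ∑ w ∈ annulus 4 r (r + 1), |h w| ≤ 80 * C / ((r : ℝ) + 1) := by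
  have hr : (0 : ℝ) < (r : ℝ) + 1 := by positivity
  calc ∑ w ∈ annulus 4 r (r + 1), |h w| ≤ ∑ w ∈ annulus 4 r (r + 1), C / ((r : ℝ) + 1) ^ 4 := by
        refine Finset.sum_le_sum fun w hw => ?_
        have h1 := hD.size w (ne_zero_of_mem_annulus hw)
        rw [supNorm_eq_of_mem_sphere hw] at h1
        push_cast at h1
        exact h1
    _ = ((annulus 4 r (r + 1)).card : ℝ) * (C / ((r : ℝ) + 1) ^ 4) := by rw [Finset.sum_const, nsmul_eq_mul]
    _ ≤ 80 * ((r : ℝ) + 1) ^ 3 * (C / ((r : ℝ) + 1) ^ 4) :=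
        mul_le_mul_of_nonneg_right (card_annulus_succ_four_le r) (div_nonneg hD.nonneg (by positivity))
    _ = 80 * C / ((r : ℝ) + 1) := by field_simp

/-! ## 3. The shell comparison `|D(2R) − D(R)| ≤ 288·C/(R+1)` -/

/-- The parity pairs over the dyadic annulus: `P(R) = annulus 4 R (2R) × {0,1}⁴`. [folklore] -/
def pairs (R : ℕ) : Finset (Pt × Pt) := annulus 4 R (2 * R) ×ˢ corners

/-- The doubling map `(v, ε) ↦ 2v + ε`. [folklore] -/
def dbl (p : Pt × Pt) : Pt := 2 • p.1 + p.2

/-- `dbl` is injective on the parity pairs. [folklore] -/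
theorem dbl_injOn (R : ℕ) : Set.InjOn dbl (pairs R : Set (Pt × Pt)) := by
  intro p hp q hq hpq
  have hp' := (Finset.mem_product.mp (Finset.mem_coe.mp hp)).2
  have hq' := (Finset.mem_product.mp (Finset.mem_coe.mp hq)).2
  obtain ⟨h1, h2⟩ := decomp_injective hp' hq' hpq
  exact Prod.ext h1 h2

/-- The image `T(R) = {2v + ε : R < ‖v‖_∞ ≤ 2R, ε ∈ {0,1}⁴}`. [folklore] -/
def dblImage (R : ℕ) : Finset Pt := (pairs R).image dbl

/-- Step 1: `Σ_{T(R)} h = Σ_{(v,ε) ∈ P(R)} h(2v + ε)`. [folklore] -/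
theorem sum_dblImage (h : Pt → ℝ) (R : ℕ) : ∑ w ∈ dblImage R, h w = ∑ p ∈ pairs R, h (dbl p) :=
  Finset.sum_image fun _ hp _ hq hpq => dbl_injOn R (Finset.mem_coe.mpr hp) (Finset.mem_coe.mpr hq) hpq

/-- Step 3(i): a point of the big annulus NOT of the form `2v + ε` with `v` in the small annulus lies on the inner sphere
`‖w‖_∞ = 2R+1`. [folklore] -/
theorem mem_sphere_of_mem_sdiff {R : ℕ} {w : Pt} (hw : w ∈ annulus 4 (2 * R) (4 * R) \ dblImage R) :
    w ∈ annulus 4 (2 * R) (2 * R + 1) := by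
  rw [Finset.mem_sdiff] at hw
  obtain ⟨hA, hT⟩ := hw
  obtain ⟨h1, h2⟩ := mem_annulus_iff.mp hA
  have hlow := two_mul_supNorm_half_le w
  have hup := supNorm_le_two_mul_supNorm_half w
  -- if `half w` were in the small annulus, `w` would be in the image
  have hv : ¬ (R < supNorm (half w)) := by
    intro hR
    apply hT
    refine Finset.mem_image.mpr ⟨(half w, parity w), ?_, two_smul_half_add_parity w⟩
    refine Finset.mem_product.mpr ⟨mem_annulus_iff.mpr ⟨hR, ?_⟩, parity_mem_corners w⟩
    show supNorm (half w) ≤ 2 * R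
    omega
  exact mem_annulus_iff.mpr ⟨h1, by omega⟩

/-- Step 3(ii): a point `2v + ε` of the image NOT in the big annulus lies on the outer sphere `‖w‖_∞ = 4R+1`.
[folklore] -/
theorem mem_sphere_of_mem_sdiff' {R : ℕ} {w : Pt} (hw : w ∈ dblImage R \ annulus 4 (2 * R) (4 * R)) :
    w ∈ annulus 4 (4 * R) (4 * R + 1) := by
  rw [Finset.mem_sdiff] at hw
  obtain ⟨hT, hA⟩ := hw
  obtain ⟨p, hp, rfl⟩ := Finset.mem_image.mp hT
  obtain ⟨hv, hε⟩ := Finset.mem_product.mp hp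
  obtain ⟨h1, h2⟩ := mem_annulus_iff.mp hv
  have hlow := two_mul_supNorm_le p.1 hε
  have hup := supNorm_two_smul_add_le p.1 hε
  rw [mem_annulus_iff] at hA ⊢
  unfold dbl at hA ⊢
  omega

/-- A finite-sum identity: `Σ_A f − Σ_T f = Σ_{A∖T} f − Σ_{T∖A} f`. [folklore] -/
theorem sum_sub_sum_eq_sdiff {α : Type*} [DecidableEq α] (A T : Finset α) (f : α → ℝ) :
    ∑ x ∈ A, f x - ∑ x ∈ T, f x = ∑ x ∈ A \ T, f x - ∑ x ∈ T \ A, f x := by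
  have hA := Finset.sum_sdiff (f := f) (Finset.inter_subset_left (s₁ := A) (s₂ := T))
  have hT := Finset.sum_sdiff (f := f) (Finset.inter_subset_right (s₁ := A) (s₂ := T))
  rw [Finset.sdiff_inter_self_left] at hA
  rw [Finset.sdiff_inter_self_right] at hT
  linarith

/-- Step 2–3: the big annulus and the image differ by at most the two sphere sums:
`|Σ_{annulus(2R,4R]} h − Σ_{T(R)} h| ≤ 80C/(2R+2) + 80C/(4R+2)`. [folklore] -/
theorem abs_sum_annulus_sub_sum_dblImage_le {h : Pt → ℝ} {C : ℝ} (hD : DyadicData h C) (R : ℕ) :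
    |∑ w ∈ annulus 4 (2 * R) (4 * R), h w - ∑ w ∈ dblImage R, h w|
      ≤ 80 * C / ((((2 * R : ℕ) : ℝ)) + 1) + 80 * C / ((((4 * R : ℕ) : ℝ)) + 1) := by
  rw [sum_sub_sum_eq_sdiff]
  have h1 : |∑ x ∈ annulus 4 (2 * R) (4 * R) \ dblImage R, h x| ≤ 80 * C / ((((2 * R : ℕ) : ℝ)) + 1) := by
    refine (Finset.abs_sum_le_sum_abs _ _).trans ?_
    refine (Finset.sum_le_sum_of_subset_of_nonneg (fun w hw => mem_sphere_of_mem_sdiff hw)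
      (fun _ _ _ => abs_nonneg _)).trans ?_
    exact sum_sphere_abs_le hD (2 * R)
  have h2 : |∑ x ∈ dblImage R \ annulus 4 (2 * R) (4 * R), h x| ≤ 80 * C / ((((4 * R : ℕ) : ℝ)) + 1) := by
    refine (Finset.abs_sum_le_sum_abs _ _).trans ?_
    refine (Finset.sum_le_sum_of_subset_of_nonneg (fun w hw => mem_sphere_of_mem_sdiff' hw)
      (fun _ _ _ => abs_nonneg _)).trans ?_
    exact sum_sphere_abs_le hD (4 * R)
  calc |∑ x ∈ annulus 4 (2 * R) (4 * R) \ dblImage R, h x - ∑ x ∈ dblImage R \ annulus 4 (2 * R) (4 * R), h x|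
      ≤ |∑ x ∈ annulus 4 (2 * R) (4 * R) \ dblImage R, h x| + |∑ x ∈ dblImage R \ annulus 4 (2 * R) (4 * R), h x| :=
        abs_sub _ _
    _ ≤ _ := add_le_add h1 h2

/-- `#pairs R ≤ 16·(4R+1)⁴`. [folklore] -/
theorem card_pairs_le (R : ℕ) : ((pairs R).card : ℝ) ≤ 16 * (4 * (R : ℝ) + 1) ^ 4 := by
  have h1 : (pairs R).card ≤ (box 4 (2 * R)).card * 16 := by
    rw [pairs, Finset.card_product, card_corners]
    exact Nat.mul_le_mul_right _ (Finset.card_le_card Finset.sdiff_subset)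
  rw [card_box] at h1
  have h2 : ((pairs R).card : ℝ) ≤ (((2 * (2 * R) + 1) ^ 4 * 16 : ℕ) : ℝ) := by exact_mod_cast h1
  refine h2.trans (le_of_eq ?_)
  push_cast
  ring

/-- Step 4: the regularity error `Σ_{P(R)} |h(2v+ε) − h(2v)| ≤ 128C/(R+1)`. [folklore] -/
theorem sum_pairs_reg_le {h : Pt → ℝ} {C : ℝ} (hD : DyadicData h C) (R : ℕ) :
    ∑ p ∈ pairs R, |h (dbl p) - h (2 • p.1)| ≤ 128 * C / ((R : ℝ) + 1) := by
  have hR : (0 : ℝ) < (R : ℝ) + 1 := by positivity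
  have hb : ∀ p ∈ pairs R, |h (dbl p) - h (2 • p.1)| ≤ C / (2 * ((R : ℝ) + 1)) ^ 5 := by
    intro p hp
    obtain ⟨hv, hε⟩ := Finset.mem_product.mp hp
    obtain ⟨h1, h2⟩ := mem_annulus_iff.mp hv
    have hn : supNorm (2 • p.1) = 2 * supNorm p.1 := supNorm_two_smul p.1
    have hge : 2 * ((R : ℝ) + 1) ≤ (supNorm (2 • p.1) : ℝ) := by
      rw [hn]; push_cast
      have : ((R : ℝ) + 1) ≤ (supNorm p.1 : ℝ) := by exact_mod_cast h1
      linarith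
    have h3 := hD.reg (2 • p.1) p.2 hε (by rw [hn]; omega)
    refine h3.trans ?_
    exact div_le_div_of_nonneg_left hD.nonneg (by positivity) (pow_le_pow_left₀ (by positivity) hge 5)
  calc ∑ p ∈ pairs R, |h (dbl p) - h (2 • p.1)| ≤ ∑ p ∈ pairs R, C / (2 * ((R : ℝ) + 1)) ^ 5 :=
        Finset.sum_le_sum hb
    _ = ((pairs R).card : ℝ) * (C / (2 * ((R : ℝ) + 1)) ^ 5) := by rw [Finset.sum_const, nsmul_eq_mul]
    _ ≤ 16 * (4 * (R : ℝ) + 1) ^ 4 * (C / (2 * ((R : ℝ) + 1)) ^ 5) :=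
        mul_le_mul_of_nonneg_right (card_pairs_le R) (div_nonneg hD.nonneg (by positivity))
    _ ≤ 16 * (4 * ((R : ℝ) + 1)) ^ 4 * (C / (2 * ((R : ℝ) + 1)) ^ 5) := by
        gcongr
        · exact div_nonneg hD.nonneg (by positivity)
        · linarith
    _ = 128 * C / ((R : ℝ) + 1) := by
        field_simp
        ring

/-- Step 5: `Σ_{(v,ε) ∈ P(R)} h(2v) = D(R)` by exact dyadic homogeneity (16 corners, factor 1/16). [folklore] -/
theorem sum_pairs_homog {h : Pt → ℝ} {C : ℝ} (hD : DyadicData h C) (R : ℕ) :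
    ∑ p ∈ pairs R, h (2 • p.1) = dyadicSum h R := by
  rw [pairs, Finset.sum_product, dyadicSum]
  refine Finset.sum_congr rfl fun v hv => ?_
  show ∑ _ε ∈ corners, h (2 • v) = h v
  rw [Finset.sum_const, card_corners, nsmul_eq_mul, hD.homog v (ne_zero_of_mem_annulus hv)]
  push_cast
  ring

/-- **THE SHELL COMPARISON**: `|D(2R) − D(R)| ≤ 288·C/(R+1)` for every `R`. [folklore] -/
theorem abs_dyadicSum_two_mul_sub_le {h : Pt → ℝ} {C : ℝ} (hD : DyadicData h C) (R : ℕ) :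
    |dyadicSum h (2 * R) - dyadicSum h R| ≤ 288 * C / ((R : ℝ) + 1) := by
  have hR : (0 : ℝ) < (R : ℝ) + 1 := by positivity
  have hC := hD.nonneg
  have e1 : dyadicSum h (2 * R) = ∑ w ∈ annulus 4 (2 * R) (4 * R), h w := by
    rw [dyadicSum]; congr 2; ring
  have s1 := abs_sum_annulus_sub_sum_dblImage_le hD R
  have s2 : |∑ w ∈ dblImage R, h w - dyadicSum h R| ≤ 128 * C / ((R : ℝ) + 1) := by
    rw [sum_dblImage, ← sum_pairs_homog hD R, ← Finset.sum_sub_distrib]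
    exact (Finset.abs_sum_le_sum_abs _ _).trans (sum_pairs_reg_le hD R)
  have t1 : 80 * C / ((((2 * R : ℕ) : ℝ)) + 1) ≤ 80 * C / ((R : ℝ) + 1) :=
    div_le_div_of_nonneg_left (by positivity) hR (by push_cast; linarith)
  have t2 : 80 * C / ((((4 * R : ℕ) : ℝ)) + 1) ≤ 80 * C / ((R : ℝ) + 1) :=
    div_le_div_of_nonneg_left (by positivity) hR (by push_cast; linarith)
  calc |dyadicSum h (2 * R) - dyadicSum h R|
      = |(∑ w ∈ annulus 4 (2 * R) (4 * R), h w - ∑ w ∈ dblImage R, h w)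
          + (∑ w ∈ dblImage R, h w - dyadicSum h R)| := by rw [e1]; ring_nf
    _ ≤ |∑ w ∈ annulus 4 (2 * R) (4 * R), h w - ∑ w ∈ dblImage R, h w|
          + |∑ w ∈ dblImage R, h w - dyadicSum h R| := abs_add_le _ _
    _ ≤ (80 * C / ((R : ℝ) + 1) + 80 * C / ((R : ℝ) + 1)) + 128 * C / ((R : ℝ) + 1) := by
        linarith [s1, s2, t1, t2]
    _ = 288 * C / ((R : ℝ) + 1) := by ring

/-! ## 4. The geometric rate of the dyadic sums `D(2^j)` and their limit -/

/-- Consecutive dyadic sums differ by at most `288C·2^{−j}`. [folklore] -/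
theorem abs_dyadicSum_pow_succ_sub_le {h : Pt → ℝ} {C : ℝ} (hD : DyadicData h C) (j : ℕ) :
    |dyadicSum h (2 ^ (j + 1)) - dyadicSum h (2 ^ j)| ≤ 288 * C / 2 ^ j := by
  rw [pow_succ, mul_comm]
  refine (abs_dyadicSum_two_mul_sub_le hD (2 ^ j)).trans ?_
  exact div_le_div_of_nonneg_left (by linarith [hD.nonneg]) (by positivity) (by push_cast; linarith)

/-- **THE RATE THEOREM.**  Under `DyadicData h C` the dyadic sums `D(2^j) = Σ_{2^j < ‖w‖_∞ ≤ 2^{j+1}} h(w)` converge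
to a limit `I` at the geometric rate `|D(2^j) − I| ≤ 576·C·2^{−j}` — the hypothesis shape `WindowLog.DyadicRate` of the
window-logarithm bookkeeping, DISCHARGED for dyadically homogeneous kernels (bridge: `dyadicRate`, §5).  No Bałaban object
enters. [folklore] -/
theorem exists_rate {h : Pt → ℝ} {C : ℝ} (hD : DyadicData h C) :
    ∃ I : ℝ, ∀ j : ℕ, |dyadicSum h (2 ^ j) - I| ≤ 576 * C / 2 ^ j := by
  set a : ℕ → ℝ := fun j => dyadicSum h (2 ^ j) with ha
  have hstep : ∀ n, dist (a n) (a (n + 1)) ≤ 576 * C / 2 / 2 ^ n := by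
    intro n
    rw [Real.dist_eq, abs_sub_comm]
    have := abs_dyadicSum_pow_succ_sub_le hD n
    refine this.trans (le_of_eq ?_)
    ring
  have hcau : CauchySeq a := cauchySeq_of_le_geometric_two hstep
  obtain ⟨I, hI⟩ := cauchySeq_tendsto_of_complete hcau
  refine ⟨I, fun j => ?_⟩
  have := dist_le_of_le_geometric_two_of_tendsto hstep hI j
  rwa [Real.dist_eq] at this

/-- The partial sums over the punctured dyadic box telescope into the unit shell plus dyadic sums:
`Σ_{0 < ‖w‖_∞ ≤ 2^J} h = Σ_{0 < ‖w‖_∞ ≤ 1} h + Σ_{j<J} D(2^j)`. [folklore] -/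
theorem sum_annulus_zero_two_pow (h : Pt → ℝ) (J : ℕ) :
    ∑ w ∈ annulus 4 0 (2 ^ J), h w
      = ∑ w ∈ annulus 4 0 1, h w + ∑ j ∈ Finset.range J, dyadicSum h (2 ^ j) := by
  induction J with
  | zero => simp
  | succ J ih =>
    rw [Finset.sum_range_succ, ← add_assoc, ← ih, dyadicSum]
    have hsplit : annulus 4 0 (2 ^ (J + 1)) = annulus 4 0 (2 ^ J) ∪ annulus 4 (2 ^ J) (2 * 2 ^ J) := by
      ext w
      simp only [Finset.mem_union, mem_annulus_iff]
      rw [pow_succ, mul_comm]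
      omega
    have hdisj : Disjoint (annulus 4 0 (2 ^ J)) (annulus 4 (2 ^ J) (2 * 2 ^ J)) := by
      rw [Finset.disjoint_left]
      intro w h1 h2
      rw [mem_annulus_iff] at h1 h2
      omega
    rw [hsplit, Finset.sum_union hdisj]

/-- **THE WINDOW LOGARITHM AT DYADIC CUT-OFFS.**  `|Σ_{0 < ‖w‖_∞ ≤ 2^J} h − J·I| ≤ Σ_{0<‖w‖_∞≤1}|h| + 1152·C`:
the punctured-box sums grow like `I·log₂(cut-off)` with an `O(1)` error, uniformly in `J`. [folklore] -/
theorem abs_sum_annulus_zero_two_pow_sub_le {h : Pt → ℝ} {C : ℝ} (hD : DyadicData h C) :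
    ∃ I : ℝ, (∀ j : ℕ, |dyadicSum h (2 ^ j) - I| ≤ 576 * C / 2 ^ j) ∧
      ∀ J : ℕ, |∑ w ∈ annulus 4 0 (2 ^ J), h w - J * I|
        ≤ |∑ w ∈ annulus 4 0 1, h w| + 1152 * C := by
  obtain ⟨I, hI⟩ := exists_rate hD
  refine ⟨I, hI, fun J => ?_⟩
  rw [sum_annulus_zero_two_pow]
  have hgeom : ∑ j ∈ Finset.range J, (576 * C / 2 ^ j : ℝ) ≤ 1152 * C := by
    have hC := hD.nonneg
    have e : ∑ j ∈ Finset.range J, (576 * C / 2 ^ j : ℝ) = 576 * C * ∑ j ∈ Finset.range J, (1 / 2 : ℝ) ^ j := by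
      rw [Finset.mul_sum]
      refine Finset.sum_congr rfl fun j _ => ?_
      rw [one_div, inv_pow]
      ring
    rw [e]
    have hs : ∑ j ∈ Finset.range J, (1 / 2 : ℝ) ^ j ≤ 2 := by
      have := sum_geometric_two_le J
      simpa [one_div] using this
    nlinarith
  have hsum : |∑ j ∈ Finset.range J, dyadicSum h (2 ^ j) - J * I| ≤ 1152 * C := by
    have e : ∑ j ∈ Finset.range J, dyadicSum h (2 ^ j) - J * I
        = ∑ j ∈ Finset.range J, (dyadicSum h (2 ^ j) - I) := by
      rw [Finset.sum_sub_distrib, Finset.sum_const, Finset.card_range, nsmul_eq_mul]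
    rw [e]
    exact (Finset.abs_sum_le_sum_abs _ _).trans ((Finset.sum_le_sum fun j _ => hI j).trans hgeom)
  calc |∑ w ∈ annulus 4 0 1, h w + ∑ j ∈ Finset.range J, dyadicSum h (2 ^ j) - J * I|
      = |∑ w ∈ annulus 4 0 1, h w + (∑ j ∈ Finset.range J, dyadicSum h (2 ^ j) - J * I)| := by ring_nf
    _ ≤ |∑ w ∈ annulus 4 0 1, h w| + |∑ j ∈ Finset.range J, dyadicSum h (2 ^ j) - J * I| := abs_add_le _ _
    _ ≤ |∑ w ∈ annulus 4 0 1, h w| + 1152 * C := by linarith [hsum]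

/-! ## 5. Bridge to `Beta.WindowLog`: `DyadicData ⇒ DyadicRate (shellSum h) I (576·C)` and the window logarithm for all `M` -/

/-- `annulus 4 a a = ∅`. [folklore] -/
theorem annulus_self (a : ℕ) : annulus 4 a a = ∅ := Finset.sdiff_self _

/-- Splitting an annulus at an intermediate radius. [folklore] -/
theorem annulus_eq_union {a b c : ℕ} (hab : a ≤ b) (hbc : b ≤ c) :
    annulus 4 a c = annulus 4 a b ∪ annulus 4 b c := by
  ext w
  simp only [Finset.mem_union, mem_annulus_iff]
  omega

/-- The two pieces are disjoint. [folklore] -/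
theorem disjoint_annulus (a b c : ℕ) : Disjoint (annulus 4 a b) (annulus 4 b c) := by
  rw [Finset.disjoint_left]
  intro w h1 h2
  rw [mem_annulus_iff] at h1 h2
  omega

/-- Shell sums over `Ico a b` recombine into the annulus sum: `Σ_{a ≤ r < b} Σ_{‖w‖_∞ = r+1} f = Σ_{a < ‖w‖_∞ ≤ b} f`.
[folklore] -/
theorem sum_Ico_shellSum (f : Pt → ℝ) {a b : ℕ} (hab : a ≤ b) :
    ∑ r ∈ Finset.Ico a b, shellSum f r = ∑ w ∈ annulus 4 a b, f w := by
  induction b, hab using Nat.le_induction with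
  | base => simp [annulus_self]
  | succ b hab ih =>
    rw [Finset.sum_Ico_succ_top hab, ih, annulus_eq_union hab (Nat.le_succ b),
      Finset.sum_union (disjoint_annulus a b (b + 1)), shellSum]

/-- The `j`-th dyadic block of the shell sums IS the dyadic sum `D(2^j)`. [folklore] -/
theorem dyadicBlock_shellSum_eq (h : Pt → ℝ) (j : ℕ) : dyadicBlock (shellSum h) j = dyadicSum h (2 ^ j) := by
  rw [dyadicBlock, sum_Ico_shellSum h (Nat.pow_le_pow_right (by norm_num) (Nat.le_succ j)), dyadicSum, pow_succ,
    mul_comm]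

/-- **`DyadicData ⇒ DyadicRate`.**  The hypothesis shape of `Beta.WindowLog` is DISCHARGED for dyadically homogeneous kernels:
`∃ I, DyadicRate (shellSum h) I (576·C)`. [folklore] -/
theorem dyadicRate {h : Pt → ℝ} {C : ℝ} (hD : DyadicData h C) : ∃ I : ℝ, DyadicRate (shellSum h) I (576 * C) := by
  obtain ⟨I, hI⟩ := exists_rate hD
  refine ⟨I, fun j => ?_⟩
  rw [dyadicBlock_shellSum_eq]
  exact hI j

/-- The shellwise marginal bound `|h(w)| ≤ C/(r+1)⁴` on `‖w‖_∞ = r+1`, from (size). [folklore] -/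
theorem shellwise_bound {h : Pt → ℝ} {C : ℝ} (hD : DyadicData h C) (r : ℕ) :
    ∀ w ∈ annulus 4 r (r + 1), |h w| ≤ C / ((r : ℝ) + 1) ^ 4 := by
  intro w hw
  have h1 := hD.size w (ne_zero_of_mem_annulus hw)
  rw [supNorm_eq_of_mem_sphere hw] at h1
  push_cast at h1
  exact h1

/-- **THE WINDOW LOGARITHM FOR DYADICALLY HOMOGENEOUS KERNELS (all cut-offs `M ≥ 1`).**  Under `DyadicData h C` there is a
number `I` (the limit of the dyadic sums, tail `576·C·2^{−j}`) with
`|Σ_{0<‖w‖_∞≤M} h(w) − (I/log 2)·log M| ≤ 1312·C + |I|` for every `M ≥ 1` — `WindowLog.windowLog_sharp` with its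
`DyadicRate` hypothesis discharged (`A = C`, rate constant `576·C`: `160·C + 2·576·C = 1312·C`). [folklore] -/
theorem windowLog {h : Pt → ℝ} {C : ℝ} (hD : DyadicData h C) :
    ∃ I : ℝ, DyadicRate (shellSum h) I (576 * C) ∧
      ∀ M : ℕ, 1 ≤ M → |∑ w ∈ annulus 4 0 M, h w - I / Real.log 2 * Real.log M| ≤ 1312 * C + |I| := by
  obtain ⟨I, hI⟩ := dyadicRate hD
  refine ⟨I, hI, fun M hM => ?_⟩
  have := windowLog_sharp hD.nonneg (by linarith [hD.nonneg] : (0 : ℝ) ≤ 576 * C) (shellwise_bound hD) hI hM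
  linarith

/-! ## 6. Continuum-homogeneous kernels restricted to `ℤ⁴` satisfy `DyadicData`

The class (L4) produces: `F : ℝ⁴ → ℝ` positively homogeneous of degree `−4` (`F(tx) = t⁻⁴F(x)`, `t > 0`), bounded on the
unit sup-sphere and Lipschitz on the closed shell `{1/2 ≤ ‖x‖_∞ ≤ 2}` (e.g. `F(x) = K(x/|x|)|x|⁻⁴` with `K` Lipschitz).  Its
restriction to `ℤ⁴` (value at `0` irrelevant: `DyadicData` never looks at `0`) satisfies `DyadicData` with `C = A + Λ`. -/

/-- The embedding `ℤ⁴ → ℝ⁴`. [folklore] -/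
def toReal (w : Pt) : Fin 4 → ℝ := fun i => (w i : ℝ)

/-- Coordinates of the embedding. [folklore] -/
@[simp] theorem toReal_apply (w : Pt) (i : Fin 4) : toReal w i = (w i : ℝ) := rfl

/-- `toReal` is additive. [folklore] -/
theorem toReal_add (v w : Pt) : toReal (v + w) = toReal v + toReal w := by
  ext i; simp [toReal]

/-- `toReal (2 • w) = 2 • toReal w`. [folklore] -/
theorem toReal_two_smul (w : Pt) : toReal (2 • w) = (2 : ℝ) • toReal w := by
  ext i
  rw [Pi.smul_apply, toReal_apply, toReal_apply, two_smul_apply, smul_eq_mul]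
  push_cast
  ring

/-- The sup-norm of `ℝ⁴` on the image of `ℤ⁴` is the integer sup-norm: `‖toReal w‖ = ‖w‖_∞`. [folklore] -/
theorem norm_toReal (w : Pt) : ‖toReal w‖ = (supNorm w : ℝ) := by
  have hcoord : ∀ i, ‖toReal w i‖ = ((w i).natAbs : ℝ) := by
    intro i
    rw [toReal_apply, Real.norm_eq_abs, Nat.cast_natAbs, Int.cast_abs]
  apply le_antisymm
  · refine (pi_norm_le_iff_of_nonneg (Nat.cast_nonneg _)).mpr fun i => ?_
    rw [hcoord]
    exact_mod_cast natAbs_le_supNorm w i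
  · obtain ⟨i, hi⟩ := exists_eq_supNorm w
    rw [← hi, ← hcoord]
    exact norm_le_pi_norm (toReal w) i

/-- `toReal w = 0 ↔ w = 0`. [folklore] -/
theorem toReal_eq_zero_iff {w : Pt} : toReal w = 0 ↔ w = 0 := by
  constructor
  · intro h
    funext i
    have := congr_fun h i
    simpa [toReal] using this
  · rintro rfl
    ext i
    simp [toReal]

/-- Perturbing by a parity corner moves the sup-norm by at most one: `‖w + ε‖_∞ ≤ ‖w‖_∞ + 1`. [folklore] -/
theorem supNorm_add_corner_le (w : Pt) {ε : Pt} (hε : ε ∈ corners) : supNorm (w + ε) ≤ supNorm w + 1 := by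
  rw [supNorm_le_iff]
  intro i
  have h1 := natAbs_le_supNorm w i
  have h2 := natAbs_le_one_of_mem_corners hε i
  have : (w + ε) i = w i + ε i := rfl
  rw [this]
  omega

/-- … and `‖w‖_∞ ≤ ‖w + ε‖_∞ + 1`. [folklore] -/
theorem supNorm_le_supNorm_add_corner (w : Pt) {ε : Pt} (hε : ε ∈ corners) : supNorm w ≤ supNorm (w + ε) + 1 := by
  rw [supNorm_le_iff]
  intro i
  have h1 := natAbs_le_supNorm (w + ε) i
  have h2 := natAbs_le_one_of_mem_corners hε i
  have : (w + ε) i = w i + ε i := rfl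
  rw [this] at h1
  omega

/-- **HYPOTHESIS SHAPE (continuum side).**  `F : ℝ⁴ → ℝ` is positively homogeneous of degree `−4`, bounded by `A` on the
unit sup-sphere, and `Λ`-Lipschitz (for the sup-norm) on the closed shell `1/2 ≤ ‖x‖_∞ ≤ 2`.  Asserted of nothing. [folklore] -/
structure HomogKernel (F : (Fin 4 → ℝ) → ℝ) (A Λ : ℝ) : Prop where
  nonneg_A : 0 ≤ A
  nonneg_Λ : 0 ≤ Λ
  homog : ∀ t : ℝ, 0 < t → ∀ x : Fin 4 → ℝ, x ≠ 0 → F (t • x) = F x / t ^ 4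
  bound : ∀ x : Fin 4 → ℝ, ‖x‖ = 1 → |F x| ≤ A
  lip : ∀ x y : Fin 4 → ℝ, 1 / 2 ≤ ‖x‖ → ‖x‖ ≤ 2 → 1 / 2 ≤ ‖y‖ → ‖y‖ ≤ 2 → |F x - F y| ≤ Λ * ‖x - y‖

/-- **Continuum-homogeneous ⇒ dyadically homogeneous on the lattice**: the restriction `w ↦ F(w)` of a `HomogKernel F A Λ`
satisfies `DyadicData _ (A + Λ)`. [folklore] -/
theorem dyadicData_of_homogKernel {F : (Fin 4 → ℝ) → ℝ} {A Λ : ℝ} (hF : HomogKernel F A Λ) :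
    DyadicData (fun w => F (toReal w)) (A + Λ) := by
  have hA := hF.nonneg_A
  have hΛ := hF.nonneg_Λ
  -- normalisation of a nonzero lattice point to the unit sup-sphere
  have key : ∀ w : Pt, w ≠ 0 →
      0 < (supNorm w : ℝ) ∧ toReal w = (supNorm w : ℝ) • ((supNorm w : ℝ)⁻¹ • toReal w) ∧
        ‖(supNorm w : ℝ)⁻¹ • toReal w‖ = 1 := by
    intro w hw
    have hn : 0 < (supNorm w : ℝ) := by exact_mod_cast supNorm_pos hw
    refine ⟨hn, ?_, ?_⟩
    · rw [smul_smul, mul_inv_cancel₀ hn.ne', one_smul]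
    · rw [norm_smul, norm_inv, Real.norm_eq_abs, abs_of_pos hn, norm_toReal, inv_mul_cancel₀ hn.ne']
  refine ⟨by positivity, ?_, ?_, ?_⟩
  · -- exact dyadic homogeneity
    intro w hw
    have hx : toReal w ≠ 0 := fun h => hw (toReal_eq_zero_iff.mp h)
    show F (toReal (2 • w)) = F (toReal w) / 16
    rw [toReal_two_smul, hF.homog 2 (by norm_num) _ hx]
    norm_num
  · -- one-step regularity
    intro w ε hε hn2
    have hw : w ≠ 0 := by
      intro h0; rw [h0, supNorm_eq_zero_iff.mpr rfl] at hn2; omega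
    have hwε : w + ε ≠ 0 := by
      intro h0
      have := supNorm_le_supNorm_add_corner w hε
      rw [h0, supNorm_eq_zero_iff.mpr rfl] at this; omega
    obtain ⟨hn, hdec, hunit⟩ := key w hw
    set n : ℝ := (supNorm w : ℝ) with hn_def
    set y : Fin 4 → ℝ := n⁻¹ • toReal w with hy
    set y' : Fin 4 → ℝ := n⁻¹ • toReal (w + ε) with hy'
    have hdec' : toReal (w + ε) = n • y' := by rw [hy', smul_smul, mul_inv_cancel₀ hn.ne', one_smul]
    have hy'norm : ‖y'‖ = (supNorm (w + ε) : ℝ) / n := by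
      rw [hy', norm_smul, norm_inv, Real.norm_eq_abs, abs_of_pos hn, norm_toReal, div_eq_inv_mul]
    have hn2' : (2 : ℝ) ≤ n := by rw [hn_def]; exact_mod_cast hn2
    have hup : (supNorm (w + ε) : ℝ) ≤ n + 1 := by rw [hn_def]; exact_mod_cast supNorm_add_corner_le w hε
    have hlow : n ≤ (supNorm (w + ε) : ℝ) + 1 := by rw [hn_def]; exact_mod_cast supNorm_le_supNorm_add_corner w hε
    have hy'1 : 1 / 2 ≤ ‖y'‖ := by
      rw [hy'norm, div_le_div_iff₀ (by norm_num) hn]; linarith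
    have hy'2 : ‖y'‖ ≤ 2 := by
      rw [hy'norm, div_le_iff₀ hn]; linarith
    have hy0 : y ≠ 0 := by
      intro h; rw [h, norm_zero] at hunit; exact zero_ne_one hunit
    have hy'0 : y' ≠ 0 := by
      intro h; rw [h, norm_zero] at hy'1; linarith
    have hdiff : y' - y = n⁻¹ • toReal ε := by
      rw [hy', hy, toReal_add, smul_add]; abel
    have hεnorm : ‖toReal ε‖ ≤ 1 := by
      rw [norm_toReal]
      have : supNorm ε ≤ 1 := supNorm_le_iff.mpr (natAbs_le_one_of_mem_corners hε)
      exact_mod_cast this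
    have hlip := hF.lip y' y hy'1 hy'2 (by rw [hunit]; norm_num) (by rw [hunit]; norm_num)
    have hlip' : |F y' - F y| ≤ Λ / n := by
      refine hlip.trans ?_
      rw [hdiff, norm_smul, norm_inv, Real.norm_eq_abs, abs_of_pos hn, div_eq_mul_inv]
      calc Λ * (n⁻¹ * ‖toReal ε‖) = Λ * n⁻¹ * ‖toReal ε‖ := by ring
        _ ≤ Λ * n⁻¹ * 1 := by gcongr
        _ = Λ * n⁻¹ := mul_one _
    show |F (toReal (w + ε)) - F (toReal w)| ≤ (A + Λ) / (supNorm w : ℝ) ^ 5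
    rw [hdec', hdec, hF.homog n hn y' hy'0, hF.homog n hn y hy0, ← hn_def, ← sub_div, abs_div,
      abs_of_pos (by positivity : (0 : ℝ) < n ^ 4), div_le_div_iff₀ (by positivity) (by positivity)]
    calc |F y' - F y| * n ^ 5 = (|F y' - F y| * n) * n ^ 4 := by ring
      _ ≤ Λ * n ^ 4 := by
          gcongr
          exact (le_div_iff₀ hn).mp hlip'
      _ ≤ (A + Λ) * n ^ 4 := by gcongr; linarith
  · -- size
    intro w hw
    obtain ⟨hn, hdec, hunit⟩ := key w hw
    set n : ℝ := (supNorm w : ℝ) with hn_def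
    set y : Fin 4 → ℝ := n⁻¹ • toReal w with hy
    have hy0 : y ≠ 0 := by
      intro h; rw [h, norm_zero] at hunit; exact zero_ne_one hunit
    show |F (toReal w)| ≤ (A + Λ) / (supNorm w : ℝ) ^ 4
    rw [hdec, hF.homog n hn y hy0, ← hn_def, abs_div, abs_of_pos (by positivity : (0 : ℝ) < n ^ 4)]
    gcongr
    linarith [hF.bound y hunit]

/-- **COROLLARY (the (L4) ⇒ (L5) interface, hypothesis-free for the class).**  For a `HomogKernel F A Λ` there is `I` with
`|Σ_{0<‖w‖_∞≤M} F(w) − (I/log 2)·log M| ≤ 1312(A + Λ) + |I|` for all `M ≥ 1`, and the dyadic lattice sums converge to `I` at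
rate `576(A+Λ)·2^{−j}`. [folklore] -/
theorem windowLog_of_homogKernel {F : (Fin 4 → ℝ) → ℝ} {A Λ : ℝ} (hF : HomogKernel F A Λ) :
    ∃ I : ℝ, DyadicRate (shellSum fun w => F (toReal w)) I (576 * (A + Λ)) ∧
      ∀ M : ℕ, 1 ≤ M →
        |∑ w ∈ annulus 4 0 M, F (toReal w) - I / Real.log 2 * Real.log M| ≤ 1312 * (A + Λ) + |I| :=
  windowLog (dyadicData_of_homogKernel hF)

/-! ## 7. Non-vacuity: the canonical marginal kernel `‖w‖_∞⁻⁴` satisfies `DyadicData _ 30` -/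

namespace Witness

/-- The canonical marginal lattice kernel `q(w) = ‖w‖_∞⁻⁴` (value `0` at `w = 0` by `1/0 = 0`). [folklore] -/
def quartic (w : Pt) : ℝ := 1 / (supNorm w : ℝ) ^ 4

/-- The elementary inequality behind one-step regularity of `‖w‖_∞⁻⁴`: for integers `n ≥ 2` and `|m − n| ≤ 1`,
`|m⁻⁴ − n⁻⁴| ≤ 30·n⁻⁵`. [folklore] -/
theorem abs_inv_pow_four_sub_le {m n : ℕ} (hn : 2 ≤ n) (h1 : n ≤ m + 1) (h2 : m ≤ n + 1) :
    |1 / (m : ℝ) ^ 4 - 1 / (n : ℝ) ^ 4| ≤ 30 / (n : ℝ) ^ 5 := by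
  have hn1 : (2 : ℝ) ≤ n := by exact_mod_cast hn
  have hn0 : (0 : ℝ) < n := by linarith
  rcases (by omega : m + 1 = n ∨ m = n ∨ m = n + 1) with hm | hm | hm
  · -- `m = n − 1 ≥ 1`: `1/m⁴ − 1/(m+1)⁴ ≤ 30/(m+1)⁵`
    have hm' : (n : ℝ) = (m : ℝ) + 1 := by rw [← hm]; push_cast; ring
    have ha : (1 : ℝ) ≤ m := by
      have : 1 ≤ m := by omega
      exact_mod_cast this
    set a : ℝ := (m : ℝ) with ha_def
    have ha0 : (0 : ℝ) < a := by linarith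
    have h2a : a ≤ a ^ 2 := by nlinarith
    have h3a : a ^ 2 ≤ a ^ 3 := by nlinarith
    have h4a : a ^ 3 ≤ a ^ 4 := by nlinarith
    rw [hm']
    have hle : 1 / (a + 1) ^ 4 ≤ 1 / a ^ 4 :=
      one_div_le_one_div_of_le (by positivity) (pow_le_pow_left₀ ha0.le (by linarith) 4)
    rw [abs_of_nonneg (sub_nonneg.mpr hle), div_sub_div 1 1 (by positivity) (by positivity),
      div_le_div_iff₀ (by positivity) (by positivity)]
    have key : ((a + 1) ^ 4 - a ^ 4) * (a + 1) ≤ 30 * a ^ 4 := by nlinarith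
    calc (1 * (a + 1) ^ 4 - a ^ 4 * 1) * (a + 1) ^ 5 = ((a + 1) ^ 4 - a ^ 4) * (a + 1) * (a + 1) ^ 4 := by ring
      _ ≤ 30 * a ^ 4 * (a + 1) ^ 4 := by gcongr
      _ = 30 * (a ^ 4 * (a + 1) ^ 4) := by ring
  · -- `m = n`
    rw [hm, sub_self, abs_zero]
    positivity
  · -- `m = n + 1`: `1/n⁴ − 1/(n+1)⁴ ≤ 30/n⁵`
    have hm' : (m : ℝ) = (n : ℝ) + 1 := by rw [hm]; push_cast; ring
    set a : ℝ := (n : ℝ) with ha_def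
    have h2a : a ≤ a ^ 2 := by nlinarith
    have h3a : a ^ 2 ≤ a ^ 3 := by nlinarith
    have h4a : a ^ 3 ≤ a ^ 4 := by nlinarith
    have h5a : a ^ 4 ≤ (a + 1) ^ 4 := pow_le_pow_left₀ hn0.le (by linarith) 4
    rw [hm']
    have hle : 1 / (a + 1) ^ 4 ≤ 1 / a ^ 4 :=
      one_div_le_one_div_of_le (by positivity) h5a
    rw [abs_sub_comm, abs_of_nonneg (sub_nonneg.mpr hle), div_sub_div 1 1 (by positivity) (by positivity),
      div_le_div_iff₀ (by positivity) (by positivity)]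
    have key : ((a + 1) ^ 4 - a ^ 4) * a ≤ 30 * (a + 1) ^ 4 := by nlinarith
    calc (1 * (a + 1) ^ 4 - a ^ 4 * 1) * a ^ 5 = ((a + 1) ^ 4 - a ^ 4) * a * a ^ 4 := by ring
      _ ≤ 30 * (a + 1) ^ 4 * a ^ 4 := by gcongr
      _ = 30 * (a ^ 4 * (a + 1) ^ 4) := by ring

/-- `‖w‖_∞⁻⁴` satisfies `DyadicData` with constant `30` (homogeneity is exact: `‖2w‖_∞ = 2‖w‖_∞`). [folklore] -/
theorem dyadicData_quartic : DyadicData quartic 30 := by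
  refine ⟨by norm_num, ?_, ?_, ?_⟩
  · intro w _
    rw [quartic, quartic, supNorm_two_smul]
    push_cast
    ring
  · intro w ε hε hn
    rw [quartic, quartic]
    exact abs_inv_pow_four_sub_le hn (supNorm_le_supNorm_add_corner w hε) (supNorm_add_corner_le w hε)
  · intro w hw
    have hn : (1 : ℝ) ≤ supNorm w := by exact_mod_cast supNorm_pos hw
    rw [quartic, abs_of_nonneg (by positivity)]
    gcongr
    norm_num

/-- Hence the sup-norm "surface" sums `Σ_{2^j<‖w‖_∞≤2^{j+1}} ‖w‖_∞⁻⁴` converge at the rate `17280·2^{−j}` and the marginal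
sum `Σ_{0<‖w‖_∞≤M} ‖w‖_∞⁻⁴` is `(I/log 2)·log M + O(1)` with an explicit `O(1)` — the rate constant of the theory is not
vacuous padding (`C = 30 > 0` is forced by (reg)/(size) here). [folklore] -/
theorem windowLog_quartic :
    ∃ I : ℝ, DyadicRate (shellSum quartic) I (576 * 30) ∧
      ∀ M : ℕ, 1 ≤ M → |∑ w ∈ annulus 4 0 M, quartic w - I / Real.log 2 * Real.log M| ≤ 1312 * 30 + |I| :=
  windowLog dyadicData_quartic

end Witness

/-! ## 8. (v1.1) Perturbed kernels: leading dyadically homogeneous part + a quintic remainder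

The shape items (L1)–(L3) are to deliver for the Ward-reorganised one-loop integrand on the fluctuation lattice: `f = h + g` with
`h` in the class `DyadicData` (e.g. `F ∘ toReal`, `F` a `HomogKernel`) and a remainder `g` one power better than marginal,
`|g(w)| ≤ C″‖w‖_∞⁻⁵` shellwise.  The remainder changes only the `O(1)`, uniformly in the cut-off
(`TransferUV.abs_sum_le_of_quintic`: `|Σ_{0<‖w‖_∞≤M} g| ≤ 160·C″`), so `f` has the SAME logarithmic coefficient `I/log 2`. -/

/-- **WINDOW LOGARITHM, PERTURBED FORM.**  If `h` satisfies `DyadicData h C` and `|g(w)| ≤ C″/(r+1)⁵` on each shell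
`‖w‖_∞ = r+1` (`C″ ≥ 0`), then with the SAME `I` (limit of the dyadic sums of `h`, tail `576·C·2^{−j}`):
`|Σ_{0<‖w‖_∞≤M} (h + g)(w) − (I/log 2)·log M| ≤ 1312·C + |I| + 160·C″` for all `M ≥ 1`. [folklore] -/
theorem windowLog_of_perturbed {h g : Pt → ℝ} {C C'' : ℝ} (hD : DyadicData h C) (hC'' : 0 ≤ C'')
    (hg : ∀ r, ∀ w ∈ annulus 4 r (r + 1), |g w| ≤ C'' / ((r : ℝ) + 1) ^ 5) :
    ∃ I : ℝ, DyadicRate (shellSum h) I (576 * C) ∧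
      ∀ M : ℕ, 1 ≤ M →
        |∑ w ∈ annulus 4 0 M, (h w + g w) - I / Real.log 2 * Real.log M| ≤ 1312 * C + |I| + 160 * C'' := by
  obtain ⟨I, hI, hwin⟩ := windowLog hD
  refine ⟨I, hI, fun M hM => ?_⟩
  have h1 := hwin M hM
  have h2 : |∑ w ∈ annulus 4 0 M, g w| ≤ 160 * C'' := TransferUV.abs_sum_le_of_quintic hC'' hg
  rw [Finset.sum_add_distrib]
  calc |∑ w ∈ annulus 4 0 M, h w + ∑ w ∈ annulus 4 0 M, g w - I / Real.log 2 * Real.log M|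
      = |(∑ w ∈ annulus 4 0 M, h w - I / Real.log 2 * Real.log M) + ∑ w ∈ annulus 4 0 M, g w| := by ring_nf
    _ ≤ |∑ w ∈ annulus 4 0 M, h w - I / Real.log 2 * Real.log M| + |∑ w ∈ annulus 4 0 M, g w| := abs_add_le _ _
    _ ≤ 1312 * C + |I| + 160 * C'' := by linarith

/-- The same for the continuum class: `f = F ∘ toReal + g`, `F` a `HomogKernel F A Λ`, `g` quintic. [folklore] -/
theorem windowLog_of_homogKernel_perturbed {F : (Fin 4 → ℝ) → ℝ} {A Λ C'' : ℝ} (hF : HomogKernel F A Λ) (hC'' : 0 ≤ C'')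
    {g : Pt → ℝ} (hg : ∀ r, ∀ w ∈ annulus 4 r (r + 1), |g w| ≤ C'' / ((r : ℝ) + 1) ^ 5) :
    ∃ I : ℝ, DyadicRate (shellSum fun w => F (toReal w)) I (576 * (A + Λ)) ∧
      ∀ M : ℕ, 1 ≤ M →
        |∑ w ∈ annulus 4 0 M, (F (toReal w) + g w) - I / Real.log 2 * Real.log M|
          ≤ 1312 * (A + Λ) + |I| + 160 * C'' :=
  windowLog_of_perturbed (dyadicData_of_homogKernel hF) hC'' hg

/-- **TWO-SIDED LOG GROWTH in the shape `Beta.LargeL` consumes.**  Writing `u(M) := Σ_{0<‖w‖_∞≤M} (h+g)(w)` and `b := I/log 2`: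
`|u(M) − b·log M| ≤ A₀` for all `M ≥ 1` with the explicit `A₀ = 1312·C + |I| + 160·C″`; in particular the ONE-SIDED form
`b·log M − A₀ ≤ u(M)` — the (AF-0-L) inequality `LogGrowthLower` for the model sequence `(L, k) ↦ u(L)`, once `b > 0` ((L5)). [folklore] -/
theorem logGrowth_two_sided {h g : Pt → ℝ} {C C'' : ℝ} (hD : DyadicData h C) (hC'' : 0 ≤ C'')
    (hg : ∀ r, ∀ w ∈ annulus 4 r (r + 1), |g w| ≤ C'' / ((r : ℝ) + 1) ^ 5) :
    ∃ I : ℝ, ∀ M : ℕ, 1 ≤ M →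
      I / Real.log 2 * Real.log M - (1312 * C + |I| + 160 * C'') ≤ ∑ w ∈ annulus 4 0 M, (h w + g w) ∧
        ∑ w ∈ annulus 4 0 M, (h w + g w) ≤ I / Real.log 2 * Real.log M + (1312 * C + |I| + 160 * C'') := by
  obtain ⟨I, -, hwin⟩ := windowLog_of_perturbed hD hC'' hg
  refine ⟨I, fun M hM => ?_⟩
  have h := abs_le.mp (hwin M hM)
  constructor <;> linarith [h.1, h.2]

/-! ## 9. (v1.2) Non-vacuity of the continuum class: `‖x‖_∞⁻⁴` is a `HomogKernel _ 1 128` -/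

namespace Witness

/-- The continuum quartic kernel `F(x) = ‖x‖_∞⁻⁴` on `ℝ⁴` (value `0` at `0`). [folklore] -/
def quarticR (x : Fin 4 → ℝ) : ℝ := 1 / ‖x‖ ^ 4

/-- On lattice points it is the lattice witness: `quarticR (toReal w) = quartic w`. [folklore] -/
theorem quarticR_toReal (w : Pt) : quarticR (toReal w) = quartic w := by
  rw [quarticR, quartic, norm_toReal]

/-- The mean-value inequality behind the Lipschitz bound: for `a, b ≥ 1/2`, `|a⁻⁴ − b⁻⁴| ≤ 128·|a − b|`
(`a⁻⁴ − b⁻⁴ = (b − a)(a⁻⁴b⁻¹ + a⁻³b⁻² + a⁻²b⁻³ + a⁻¹b⁻⁴)`, each term `≤ 2⁵`). [folklore] -/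
theorem abs_inv_pow_four_sub_le_real {a b : ℝ} (ha : 1 / 2 ≤ a) (hb : 1 / 2 ≤ b) :
    |1 / a ^ 4 - 1 / b ^ 4| ≤ 128 * |a - b| := by
  have ha0 : 0 < a := by linarith
  have hb0 : 0 < b := by linarith
  have h2a : 1 ≤ 2 * a := by linarith
  have h2b : 1 ≤ 2 * b := by linarith
  -- the four elementary products `(2a)^i (2b)^(5-i) ≥ 1`
  have p1 : 1 ≤ (2 * a) ^ 4 * (2 * b) := one_le_mul_of_one_le_of_one_le (one_le_pow₀ h2a) h2b
  have p2 : 1 ≤ (2 * a) ^ 3 * (2 * b) ^ 2 := one_le_mul_of_one_le_of_one_le (one_le_pow₀ h2a) (one_le_pow₀ h2b)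
  have p3 : 1 ≤ (2 * a) ^ 2 * (2 * b) ^ 3 := one_le_mul_of_one_le_of_one_le (one_le_pow₀ h2a) (one_le_pow₀ h2b)
  have p4 : 1 ≤ (2 * a) * (2 * b) ^ 4 := one_le_mul_of_one_le_of_one_le h2a (one_le_pow₀ h2b)
  have key : b ^ 3 + b ^ 2 * a + b * a ^ 2 + a ^ 3 ≤ 128 * (a ^ 4 * b ^ 4) := by
    have q1 : b ^ 3 ≤ b ^ 3 * ((2 * a) ^ 4 * (2 * b)) := le_mul_of_one_le_right (by positivity) p1
    have q2 : b ^ 2 * a ≤ b ^ 2 * a * ((2 * a) ^ 3 * (2 * b) ^ 2) := le_mul_of_one_le_right (by positivity) p2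
    have q3 : b * a ^ 2 ≤ b * a ^ 2 * ((2 * a) ^ 2 * (2 * b) ^ 3) := le_mul_of_one_le_right (by positivity) p3
    have q4 : a ^ 3 ≤ a ^ 3 * ((2 * a) * (2 * b) ^ 4) := le_mul_of_one_le_right (by positivity) p4
    have e : b ^ 3 * ((2 * a) ^ 4 * (2 * b)) + b ^ 2 * a * ((2 * a) ^ 3 * (2 * b) ^ 2)
        + b * a ^ 2 * ((2 * a) ^ 2 * (2 * b) ^ 3) + a ^ 3 * ((2 * a) * (2 * b) ^ 4) = 128 * (a ^ 4 * b ^ 4) := by ring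
    linarith
  have e1 : 1 / a ^ 4 - 1 / b ^ 4 = (b - a) * ((b ^ 3 + b ^ 2 * a + b * a ^ 2 + a ^ 3) / (a ^ 4 * b ^ 4)) := by
    field_simp
    ring
  rw [e1, abs_mul, abs_of_nonneg (by positivity : (0 : ℝ) ≤ (b ^ 3 + b ^ 2 * a + b * a ^ 2 + a ^ 3) / (a ^ 4 * b ^ 4)),
    abs_sub_comm, mul_comm]
  refine mul_le_mul_of_nonneg_right ?_ (abs_nonneg _)
  rw [div_le_iff₀ (by positivity)]
  exact key

/-- **`‖x‖_∞⁻⁴` is a `HomogKernel` with `A = 1`, `Λ = 128`** — the continuum hypothesis structure of §6 is inhabited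
non-trivially (degree `−4` homogeneity from `‖tx‖ = t‖x‖`; the Lipschitz bound from `abs_inv_pow_four_sub_le_real` and
`|‖x‖ − ‖y‖| ≤ ‖x − y‖`). [folklore] -/
theorem homogKernel_quarticR : HomogKernel quarticR 1 128 := by
  refine ⟨by norm_num, by norm_num, ?_, ?_, ?_⟩
  · intro t ht x _
    rw [quarticR, quarticR, norm_smul, Real.norm_eq_abs, abs_of_pos ht, mul_pow]
    field_simp
  · intro x hx
    rw [quarticR, hx]
    norm_num
  · intro x y hx1 _ hy1 _
    rw [quarticR, quarticR]
    refine (abs_inv_pow_four_sub_le_real hx1 hy1).trans ?_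
    exact mul_le_mul_of_nonneg_left (abs_norm_sub_norm_le x y) (by norm_num)

/-- Hence, through §6, the lattice restriction satisfies `DyadicData _ (1 + 128)` — consistent with (weaker than) the direct
lattice constant `30` of `dyadicData_quartic`; both routes to the same kernel are exercised. [folklore] -/
theorem dyadicData_quarticR : DyadicData (fun w => quarticR (toReal w)) (1 + 128) :=
  dyadicData_of_homogKernel homogKernel_quarticR

end Witness

/-! ## 10. (v1.3) The SIGN of the coefficient from pointwise facts: lower bounds pass to the limit; a positivity cube

For the (L5) road: if the leading kernel is pointwise `≥ 0` on the shell and `≥ c > 0` on some cube of side `δ` inside the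
open shell (e.g. the transverse structure `x₁²x₂²/|x|⁸` times a positive scalar), then every dyadic sum is `≥ c(δ/2)⁴` once
`δ·R ≥ 2`, hence `I ≥ c(δ/2)⁴ > 0` — the sign of `I` is the sign of ONE scalar in front of a nonnegative homogeneous structure. -/

/-- Eventual lower bounds of the block sums pass to the limit of a `DyadicRate`. [folklore] -/
theorem le_of_dyadicRate {T : ℕ → ℝ} {I C₀ ℓ : ℝ} {j₀ : ℕ} (hI : DyadicRate T I C₀) (hℓ : ∀ j, j₀ ≤ j → ℓ ≤ dyadicBlock T j) :
    ℓ ≤ I := by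
  by_contra hlt
  have hlt : I < ℓ := not_le.mp hlt
  have hε : 0 < ℓ - I := sub_pos.mpr hlt
  obtain ⟨j, hj⟩ := pow_unbounded_of_one_lt (max C₀ 0 / (ℓ - I) + j₀) (by norm_num : (1 : ℝ) < 2)
  -- take `j' = j + j₀ ≥ j₀`, with `2^{j'} ≥ 2^j > C₀/(ℓ-I)`
  have hj' : max C₀ 0 / (ℓ - I) < (2 : ℝ) ^ (j + j₀) := by
    have h1 : (2 : ℝ) ^ j ≤ 2 ^ (j + j₀) := pow_le_pow_right₀ (by norm_num) (Nat.le_add_right j j₀)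
    have h2 : (0 : ℝ) ≤ j₀ := Nat.cast_nonneg j₀
    linarith
  have hb := hI (j + j₀)
  have hl := hℓ (j + j₀) (Nat.le_add_left j₀ j)
  have hpow : (0 : ℝ) < 2 ^ (j + j₀) := by positivity
  have hC : C₀ / 2 ^ (j + j₀) < ℓ - I := by
    rw [div_lt_iff₀ hpow]
    rw [div_lt_iff₀ hε] at hj'
    have : C₀ ≤ max C₀ 0 := le_max_left _ _
    nlinarith
  have h3 := (abs_le.mp hb).2
  linarith

/-- The integer points `w` with `R·x₀ᵢ ≤ wᵢ ≤ R·x₀ᵢ + R·δ` contain a product of integer intervals of length `⌊Rδ⌋`, hence at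
least `⌊Rδ⌋⁴` points; we use the explicit sub-box `Π_i [⌈R x₀ᵢ⌉, ⌈R x₀ᵢ⌉ + m − 1]`, `m = ⌊R δ⌋`. [folklore] -/
def subBox (x₀ : Fin 4 → ℝ) (R : ℕ) (m : ℕ) : Finset Pt :=
  Fintype.piFinset fun i => Finset.Ico ⌈(R : ℝ) * x₀ i⌉ (⌈(R : ℝ) * x₀ i⌉ + m)

/-- Its cardinality is `m⁴`. [folklore] -/
theorem card_subBox (x₀ : Fin 4 → ℝ) (R m : ℕ) : (subBox x₀ R m).card = m ^ 4 := by
  rw [subBox, Fintype.card_piFinset]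
  simp [Finset.prod_const]

/-- Points of the sub-box, rescaled by `R`, lie in the cube `x₀ + [0, δ]⁴` when `m ≤ R·δ`. [folklore] -/
theorem mem_cube_of_mem_subBox {x₀ : Fin 4 → ℝ} {R m : ℕ} {δ : ℝ} (hR : 0 < R) (hm : (m : ℝ) ≤ R * δ) {w : Pt}
    (hw : w ∈ subBox x₀ R m) (i : Fin 4) :
    x₀ i ≤ (R : ℝ)⁻¹ * (w i : ℝ) ∧ (R : ℝ)⁻¹ * (w i : ℝ) ≤ x₀ i + δ := by
  have hRr : (0 : ℝ) < R := by exact_mod_cast hR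
  have hi := Fintype.mem_piFinset.mp hw i
  rw [Finset.mem_Ico] at hi
  obtain ⟨h1, h2⟩ := hi
  have hceil := Int.le_ceil ((R : ℝ) * x₀ i)
  have hceil' := Int.ceil_lt_add_one ((R : ℝ) * x₀ i)
  have h1' : (R : ℝ) * x₀ i ≤ (w i : ℝ) := hceil.trans (by exact_mod_cast h1)
  have h2' : (w i : ℝ) ≤ (R : ℝ) * x₀ i + m := by
    have : (w i : ℝ) ≤ ((⌈(R : ℝ) * x₀ i⌉ + m - 1 : ℤ) : ℝ) := by exact_mod_cast (by omega : w i ≤ ⌈(R : ℝ) * x₀ i⌉ + m - 1)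
    push_cast at this
    linarith
  constructor
  · rw [le_inv_mul_iff₀ hRr]; linarith
  · rw [inv_mul_le_iff₀ hRr]; nlinarith

/-- **POSITIVITY CUBE ⇒ UNIFORM LOWER BOUND OF THE DYADIC SUMS.**  Let `F : ℝ⁴ → ℝ` be positively homogeneous of degree `−4`,
`≥ 0` on the shell `1 < ‖x‖_∞ ≤ 2`, and `≥ c` on a cube `x₀ + [0,δ]⁴` contained in that shell.  Then for every `R` with
`R·δ ≥ 2`: `c·(δ/2)⁴ ≤ D(R)` for the lattice restriction `w ↦ F(w)`. [folklore] -/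
theorem dyadicSum_ge_of_cube {F : (Fin 4 → ℝ) → ℝ} (hhom : ∀ t : ℝ, 0 < t → ∀ x : Fin 4 → ℝ, x ≠ 0 → F (t • x) = F x / t ^ 4)
    (hnn : ∀ x : Fin 4 → ℝ, 1 < ‖x‖ → ‖x‖ ≤ 2 → 0 ≤ F x) {x₀ : Fin 4 → ℝ} {δ c : ℝ} (hc : 0 ≤ c)
    (hshell : ∀ x : Fin 4 → ℝ, (∀ i, x₀ i ≤ x i ∧ x i ≤ x₀ i + δ) → 1 < ‖x‖ ∧ ‖x‖ ≤ 2)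
    (hFc : ∀ x : Fin 4 → ℝ, (∀ i, x₀ i ≤ x i ∧ x i ≤ x₀ i + δ) → c ≤ F x) {R : ℕ} (hRδ : 2 ≤ (R : ℝ) * δ) :
    c * (δ / 2) ^ 4 ≤ dyadicSum (fun w => F (toReal w)) R := by
  -- `R ≥ 1` and the rescaling `x = R⁻¹ • toReal w`
  have hR : 0 < R := by
    rcases Nat.eq_zero_or_pos R with h | h
    · subst h; simp at hRδ; linarith
    · exact h
  have hRr : (0 : ℝ) < R := by exact_mod_cast hR
  have hδ : 0 < δ := by
    by_contra h
    have h' : δ ≤ 0 := not_lt.mp h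
    have : (R : ℝ) * δ ≤ 0 := mul_nonpos_iff.mpr (Or.inl ⟨hRr.le, h'⟩)
    linarith
  -- value of `F` at a lattice point in terms of the rescaled point
  have hval : ∀ w : Pt, w ≠ 0 → F (toReal w) = F ((R : ℝ)⁻¹ • toReal w) / (R : ℝ) ^ 4 := by
    intro w hw
    have hx : (R : ℝ)⁻¹ • toReal w ≠ 0 := by
      intro h
      rw [smul_eq_zero] at h
      rcases h with h | h
      · exact (inv_ne_zero hRr.ne') h
      · exact hw (toReal_eq_zero_iff.mp h)
    have := hhom R hRr _ hx
    rw [smul_smul, mul_inv_cancel₀ hRr.ne', one_smul] at this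
    exact this
  have hnorm : ∀ w : Pt, ‖(R : ℝ)⁻¹ • toReal w‖ = (supNorm w : ℝ) / R := by
    intro w
    rw [norm_smul, norm_inv, Real.norm_eq_abs, abs_of_pos hRr, norm_toReal, div_eq_inv_mul]
  -- the sub-box with `m = ⌊R δ⌋`
  set m : ℕ := ⌊(R : ℝ) * δ⌋₊ with hm
  have hmle : (m : ℝ) ≤ R * δ := Nat.floor_le (by positivity)
  have hmge : (R : ℝ) * δ / 2 ≤ m := by
    have := Nat.lt_floor_add_one ((R : ℝ) * δ)
    rw [← hm] at this
    linarith
  have hsub : subBox x₀ R m ⊆ annulus 4 R (2 * R) := by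
    intro w hw
    have hcube := fun i => mem_cube_of_mem_subBox hR hmle hw i
    have hx := hshell ((R : ℝ)⁻¹ • toReal w) (fun i => by
      have := hcube i
      simpa [Pi.smul_apply, smul_eq_mul, toReal_apply] using this)
    rw [hnorm w] at hx
    obtain ⟨h1, h2⟩ := hx
    rw [lt_div_iff₀ hRr] at h1
    rw [div_le_iff₀ hRr] at h2
    rw [mem_annulus_iff]
    constructor
    · exact_mod_cast (by linarith : (R : ℝ) < supNorm w)
    · exact_mod_cast (by linarith : (supNorm w : ℝ) ≤ 2 * R)
  -- every term of `D(R)` is `≥ 0`, the sub-box terms are `≥ c/R⁴`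
  have hterm_nn : ∀ w ∈ annulus 4 R (2 * R), 0 ≤ F (toReal w) := by
    intro w hw
    have hw0 := ne_zero_of_mem_annulus hw
    obtain ⟨h1, h2⟩ := mem_annulus_iff.mp hw
    rw [hval w hw0]
    refine div_nonneg (hnn _ ?_ ?_) (by positivity)
    · rw [hnorm, lt_div_iff₀ hRr, one_mul]; exact_mod_cast h1
    · rw [hnorm, div_le_iff₀ hRr]; exact_mod_cast h2
  have hterm_c : ∀ w ∈ subBox x₀ R m, c / (R : ℝ) ^ 4 ≤ F (toReal w) := by
    intro w hw
    have hw0 := ne_zero_of_mem_annulus (hsub hw)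
    rw [hval w hw0]
    gcongr
    refine hFc _ fun i => ?_
    have := mem_cube_of_mem_subBox hR hmle hw i
    simpa [Pi.smul_apply, smul_eq_mul, toReal_apply] using this
  calc c * (δ / 2) ^ 4 = (((R : ℝ) * δ / 2) ^ 4) * (c / (R : ℝ) ^ 4) := by field_simp
    _ ≤ ((m : ℝ) ^ 4) * (c / (R : ℝ) ^ 4) := by gcongr
    _ = ∑ w ∈ subBox x₀ R m, c / (R : ℝ) ^ 4 := by
        rw [Finset.sum_const, card_subBox, nsmul_eq_mul]; push_cast; ring
    _ ≤ ∑ w ∈ subBox x₀ R m, F (toReal w) := Finset.sum_le_sum hterm_c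
    _ ≤ ∑ w ∈ annulus 4 R (2 * R), F (toReal w) :=
        Finset.sum_le_sum_of_subset_of_nonneg hsub fun w hw _ => hterm_nn w hw
    _ = dyadicSum (fun w => F (toReal w)) R := rfl

/-- **THE SIGN OF `I` FROM POINTWISE FACTS.**  For a `HomogKernel F A Λ` that is `≥ 0` on the shell and `≥ c > 0` on a cube
`x₀ + [0,δ]⁴` inside the shell (`δ > 0`), the coefficient `I` of `windowLog_of_homogKernel` satisfies `I ≥ c·(δ/2)⁴ > 0`.
This is the kernel form of (L5) once (L1)–(L3) deliver the leading kernel as (positive scalar) × (nonnegative structure).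
[folklore] -/
theorem coeff_pos_of_cube {F : (Fin 4 → ℝ) → ℝ} {A Λ : ℝ} (hF : HomogKernel F A Λ)
    (hnn : ∀ x : Fin 4 → ℝ, 1 < ‖x‖ → ‖x‖ ≤ 2 → 0 ≤ F x) {x₀ : Fin 4 → ℝ} {δ c : ℝ} (hδ : 0 < δ) (hc : 0 < c)
    (hshell : ∀ x : Fin 4 → ℝ, (∀ i, x₀ i ≤ x i ∧ x i ≤ x₀ i + δ) → 1 < ‖x‖ ∧ ‖x‖ ≤ 2)
    (hFc : ∀ x : Fin 4 → ℝ, (∀ i, x₀ i ≤ x i ∧ x i ≤ x₀ i + δ) → c ≤ F x)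
    {I C₀ : ℝ} (hI : DyadicRate (shellSum fun w => F (toReal w)) I C₀) :
    c * (δ / 2) ^ 4 ≤ I ∧ 0 < I := by
  -- choose `j₀` with `2^{j₀}·δ ≥ 2`
  obtain ⟨j₀, hj₀⟩ := pow_unbounded_of_one_lt (2 / δ) (by norm_num : (1 : ℝ) < 2)
  have hle : c * (δ / 2) ^ 4 ≤ I := by
    refine le_of_dyadicRate hI (j₀ := j₀) fun j hj => ?_
    rw [dyadicBlock_shellSum_eq]
    refine dyadicSum_ge_of_cube hF.homog hnn hc.le hshell hFc ?_
    have h1 : (2 : ℝ) ^ j₀ ≤ 2 ^ j := pow_le_pow_right₀ (by norm_num) hj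
    have h2 : 2 / δ < 2 ^ j₀ := hj₀
    rw [div_lt_iff₀ hδ] at h2
    push_cast
    nlinarith
  exact ⟨hle, lt_of_lt_of_le (by positivity) hle⟩

/-! ## 11. (v1.4) The hypothesis classes are cones: sums and scalar multiples (assembling the leading kernel from pieces)

The (S′-exact) organisation delivers the one-loop integrand as a SUM of pieces (bulk, unit, ghost-bulk, ghost-unit); the
leading kernel is assembled piecewise.  Both classes are closed under addition and real scalar multiplication, with the
obvious constants, and the dyadic sums / coefficients add. -/

namespace DyadicData

variable {h₁ h₂ : Pt → ℝ} {C₁ C₂ : ℝ}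

/-- Sum of two dyadically homogeneous kernels. [folklore] -/
theorem add (hD₁ : DyadicData h₁ C₁) (hD₂ : DyadicData h₂ C₂) : DyadicData (fun w => h₁ w + h₂ w) (C₁ + C₂) := by
  refine ⟨add_nonneg hD₁.nonneg hD₂.nonneg, ?_, ?_, ?_⟩
  · intro w hw
    rw [hD₁.homog w hw, hD₂.homog w hw]
    ring
  · intro w ε hε hn
    have h1 := hD₁.reg w ε hε hn
    have h2 := hD₂.reg w ε hε hn
    calc |h₁ (w + ε) + h₂ (w + ε) - (h₁ w + h₂ w)| = |(h₁ (w + ε) - h₁ w) + (h₂ (w + ε) - h₂ w)| := by ring_nf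
      _ ≤ |h₁ (w + ε) - h₁ w| + |h₂ (w + ε) - h₂ w| := abs_add_le _ _
      _ ≤ C₁ / (supNorm w : ℝ) ^ 5 + C₂ / (supNorm w : ℝ) ^ 5 := add_le_add h1 h2
      _ = (C₁ + C₂) / (supNorm w : ℝ) ^ 5 := by ring
  · intro w hw
    have h1 := hD₁.size w hw
    have h2 := hD₂.size w hw
    calc |h₁ w + h₂ w| ≤ |h₁ w| + |h₂ w| := abs_add_le _ _
      _ ≤ C₁ / (supNorm w : ℝ) ^ 4 + C₂ / (supNorm w : ℝ) ^ 4 := add_le_add h1 h2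
      _ = (C₁ + C₂) / (supNorm w : ℝ) ^ 4 := by ring

/-- Real scalar multiple of a dyadically homogeneous kernel (constant `|κ|·C`). [folklore] -/
theorem smul (hD : DyadicData h₁ C₁) (κ : ℝ) : DyadicData (fun w => κ * h₁ w) (|κ| * C₁) := by
  refine ⟨mul_nonneg (abs_nonneg κ) hD.nonneg, ?_, ?_, ?_⟩
  · intro w hw
    rw [hD.homog w hw]
    ring
  · intro w ε hε hn
    have h1 := hD.reg w ε hε hn
    rw [← mul_sub, abs_mul, mul_div_assoc]
    exact mul_le_mul_of_nonneg_left h1 (abs_nonneg κ)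
  · intro w hw
    have h1 := hD.size w hw
    rw [abs_mul, mul_div_assoc]
    exact mul_le_mul_of_nonneg_left h1 (abs_nonneg κ)

end DyadicData

/-- The dyadic sums are linear in the kernel. [folklore] -/
theorem dyadicSum_add (h₁ h₂ : Pt → ℝ) (R : ℕ) :
    dyadicSum (fun w => h₁ w + h₂ w) R = dyadicSum h₁ R + dyadicSum h₂ R := by
  rw [dyadicSum, dyadicSum, dyadicSum, Finset.sum_add_distrib]

/-- … and homogeneous. [folklore] -/
theorem dyadicSum_smul (h : Pt → ℝ) (κ : ℝ) (R : ℕ) : dyadicSum (fun w => κ * h w) R = κ * dyadicSum h R := by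
  rw [dyadicSum, dyadicSum, Finset.mul_sum]

/-- Coefficients add: rates for `h₁`, `h₂` give a rate for `h₁ + h₂` with limit `I₁ + I₂`. [folklore] -/
theorem dyadicRate_add {h₁ h₂ : Pt → ℝ} {I₁ I₂ C₁ C₂ : ℝ} (r₁ : DyadicRate (shellSum h₁) I₁ C₁)
    (r₂ : DyadicRate (shellSum h₂) I₂ C₂) : DyadicRate (shellSum fun w => h₁ w + h₂ w) (I₁ + I₂) (C₁ + C₂) := by
  intro j
  have e : dyadicBlock (shellSum fun w => h₁ w + h₂ w) j = dyadicBlock (shellSum h₁) j + dyadicBlock (shellSum h₂) j := by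
    rw [dyadicBlock_shellSum_eq, dyadicBlock_shellSum_eq, dyadicBlock_shellSum_eq, dyadicSum_add]
  rw [e]
  calc |dyadicBlock (shellSum h₁) j + dyadicBlock (shellSum h₂) j - (I₁ + I₂)|
      = |(dyadicBlock (shellSum h₁) j - I₁) + (dyadicBlock (shellSum h₂) j - I₂)| := by ring_nf
    _ ≤ |dyadicBlock (shellSum h₁) j - I₁| + |dyadicBlock (shellSum h₂) j - I₂| := abs_add_le _ _
    _ ≤ C₁ / 2 ^ j + C₂ / 2 ^ j := add_le_add (r₁ j) (r₂ j)
    _ = (C₁ + C₂) / 2 ^ j := by ring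

/-- Coefficients scale: a rate for `h` gives a rate for `κ·h` with limit `κ·I`. [folklore] -/
theorem dyadicRate_smul {h : Pt → ℝ} {I C₀ : ℝ} (r : DyadicRate (shellSum h) I C₀) (κ : ℝ) :
    DyadicRate (shellSum fun w => κ * h w) (κ * I) (|κ| * C₀) := by
  intro j
  have e : dyadicBlock (shellSum fun w => κ * h w) j = κ * dyadicBlock (shellSum h) j := by
    rw [dyadicBlock_shellSum_eq, dyadicBlock_shellSum_eq, dyadicSum_smul]
  rw [e, ← mul_sub, abs_mul, mul_div_assoc]
  exact mul_le_mul_of_nonneg_left (r j) (abs_nonneg κ)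

namespace HomogKernel

variable {F₁ F₂ : (Fin 4 → ℝ) → ℝ} {A₁ Λ₁ A₂ Λ₂ : ℝ}

/-- Sum of two continuum-homogeneous kernels. [folklore] -/
theorem add (hF₁ : HomogKernel F₁ A₁ Λ₁) (hF₂ : HomogKernel F₂ A₂ Λ₂) :
    HomogKernel (fun x => F₁ x + F₂ x) (A₁ + A₂) (Λ₁ + Λ₂) := by
  refine ⟨add_nonneg hF₁.nonneg_A hF₂.nonneg_A, add_nonneg hF₁.nonneg_Λ hF₂.nonneg_Λ, ?_, ?_, ?_⟩
  · intro t ht x hx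
    rw [hF₁.homog t ht x hx, hF₂.homog t ht x hx]
    ring
  · intro x hx
    exact (abs_add_le _ _).trans (add_le_add (hF₁.bound x hx) (hF₂.bound x hx))
  · intro x y hx1 hx2 hy1 hy2
    have h1 := hF₁.lip x y hx1 hx2 hy1 hy2
    have h2 := hF₂.lip x y hx1 hx2 hy1 hy2
    calc |F₁ x + F₂ x - (F₁ y + F₂ y)| = |(F₁ x - F₁ y) + (F₂ x - F₂ y)| := by ring_nf
      _ ≤ |F₁ x - F₁ y| + |F₂ x - F₂ y| := abs_add_le _ _
      _ ≤ Λ₁ * ‖x - y‖ + Λ₂ * ‖x - y‖ := add_le_add h1 h2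
      _ = (Λ₁ + Λ₂) * ‖x - y‖ := by ring

/-- Real scalar multiple of a continuum-homogeneous kernel. [folklore] -/
theorem smul (hF : HomogKernel F₁ A₁ Λ₁) (κ : ℝ) : HomogKernel (fun x => κ * F₁ x) (|κ| * A₁) (|κ| * Λ₁) := by
  refine ⟨mul_nonneg (abs_nonneg κ) hF.nonneg_A, mul_nonneg (abs_nonneg κ) hF.nonneg_Λ, ?_, ?_, ?_⟩
  · intro t ht x hx
    rw [hF.homog t ht x hx]
    ring
  · intro x hx
    rw [abs_mul]
    exact mul_le_mul_of_nonneg_left (hF.bound x hx) (abs_nonneg κ)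
  · intro x y hx1 hx2 hy1 hy2
    rw [← mul_sub, abs_mul, mul_assoc]
    exact mul_le_mul_of_nonneg_left (hF.lip x y hx1 hx2 hy1 hy2) (abs_nonneg κ)

end HomogKernel

end

end Literature.MathematicalPhysics.QuantumFieldTheory.Balaban1983to89.Beta.DyadicShell
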